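import Literature.MathematicalPhysics.QuantumFieldTheory.Balaban1983to89.B1Eq343FluctuationChi
import Literature.MathematicalPhysics.QuantumFieldTheory.Balaban1983to89.HiggsCondGauss228
import Literature.MathematicalPhysics.QuantumFieldTheory.Balaban1983to89.HiggsFluctMeasurePos

/-!
# `Balaban1983to89.B1Eq356FluctuationIntegral` — T. Bałaban, *(Higgs)₂,₃ quantum fields in a finite volume. I. A lower
bound*, Commun. Math. Phys. **85** (1982) 603–626 [Balaban1982Higgs1] p. 622 [PDF 20], **(3.56): THE FLUCTUATION INTEGRAL
`∫dμ_{C^{(k)}}(A′) ∫dμ_{C^{(k)}(B^{(k+1)})}(φ′) χ(A′)χ(φ′) exp(V^{(k)})` WITH BODY on the concrete (Higgs)₂,₃ carrier** — the two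
Gaussian probability measures of the tree (the typer's `HiggsFluctMeasure.fluctMeasure` = `dμ_{C^{(k)}}` of the vector
fluctuation field, the typer's `HiggsCondGauss228.condGauss` (on p15's `gaussProb`) at `Λ = T^{(k)}` = `dμ_{C^{(k)}(B^{(k+1)})}` of the scalar one), the two
small-fluctuation characteristic functions of (3.43)/(3.50) (`B1Eq343FluctuationChi.chiFluctA`/`chiFluctφ`), and the
polynomial `V^{(k)}` as the argument print gives it; identified `rfl` with r12's schematic decl of record
`B1Sect3Statements.integral356`; elementary consequences PROVED (nonnegativity; `≤ e^{M}` when `V^{(k)} ≤ M`; the value at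
`V = 0` is the product of the two small-field probabilities, in `[0, 1]`)

statement-level skeleton of published theorems with citation tags; proofs where landed; nothing here is a claim about the Yang–Mills mass gap

PDF held: `paper:balaban1982-cmp85-higgs23-i` (journal page = PDF page + 602); p. 622 read AS IMAGE on the ×2 render
`run/shared/lean/pub/pub-balaban/b2b-balaban-ref1/pages/1982-cmp85-higgs23-I/1982-cmp85-higgs23-I-p020-x2.png`.

CITATION HEADER (lean-in-tree rule).  lit-balaban typed skeleton (HOME `run/shared/lean/pub/lit-balaban/`), reader line r14
(unit `lit-balaban-r14`, gen 23; B1 fold owner and, under lead ruling G.5-57, proxy constituent for r12's `ROWS-B1-part2.md`);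
SKELETON row **B1.Eq3.56** (r12's row, `typed p239973`, decl of record r12's SCHEMATIC `B1Sect3Statements.integral356 μA μφ χA χφ V`
— any measures, any cut-offs; r14's pre-audit `READING-RULE-PREAUDIT-B1-part2-g23.md` §3 class E: *"THE fluctuation integral —
schematic only"*).  THIS FILE is the carrier member.  USED BY NAME, nothing re-declared: `HiggsFluctMeasure.fluctMeasure` (typer;
III (1.4) / I (3.35): the centred Gaussian probability measure of `A′` with covariance `C^{(k),L^kε}`, a probability measure by
`HiggsFluctMeasurePos.fluctMeasure_isProbability`), `HiggsCondGauss228.condGauss`/`fieldOfCrd` (typer g5; the Gaussian probability measure of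
the scalar fluctuation field with covariance `C^{(k)}_Λ(Ω, B)` of I (2.32) in the integration coordinates of II (2.28); at `Λ = T^{(k)}`
there is nothing to condition on and `C^{(k)}_{T^{(k)}}(Ω, B) = C^{(k)}(Ω, B)` of (2.30); a probability measure by
`isProbabilityMeasure_condGauss`), `B1Eq343FluctuationChi.chiFluctA`/`chiFluctφ` (r14 g23, (3.43)/(3.50) with body),
`B1Sect3Statements.integral356` (r12).

THE SOURCE TEXT, p. 622 [PDF 20], verbatim (read on the render): *"The next step is a calculation of the integral
∫dμ_{C^{(k)}}(A′) ∫dμ_{C^{(k)}(B^{(k+1)})}(φ′) χ(A′)χ(φ′) exp(V^{(k)}). (3.56)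
Again we will use the lemma from [2]. The following theorem clarifies that the assumptions of the lemma are satisfied in
our case. Proposition 3.2. The function V^{(k)}(B^{(k+1)}, ψ, A′^{(k)}, φ′) has the form … (3.57)"*.  Just before, (3.55) p. 622
displays the lower bound for *"(the right side of (3.51))"* in which the same double integral appears multiplied by the SEPARATED
normalisations `(∫dA′ exp(−½⟨A′,(C^{(k)})⁻¹A′⟩))(∫dφ′ exp(−½⟨φ′,(C^{(k)}(B^{(k+1)}))⁻¹φ′⟩))` — so `dμ_{C^{(k)}}`, `dμ_{C^{(k)}(B^{(k+1)})}`
are the NORMALISED (probability) Gaussian measures; the cut-offs are (3.43) p. 619 *"χ(A′) = Π_{x∈T₁^{(k)}} χ({|A′(x)| ≦ p₁(L^kε)})"*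
and (3.50) p. 621 *"χ(φ′) = Π_{x∈T₁^{(k)}} χ({|φ′(x)| ≦ p₁(L^kε)})"*.  [Balaban1982Higgs2] p. 582 cites the display as *"(I.3.56)"*.

HOW IT IS TYPED.  Level `k` of the `ε`-lattice family `P` (`P.mesh k = L^kε`); the vector fluctuation field `A′` is a bond
function on `T^{(k)}` (`HiggsLattice.VecField P k`, the carrier of `fluctMeasure`; vector mass `μ₀²`, p. 605); the scalar
fluctuation field `φ′ : T^{(k)} → ℝ^N` is integrated in the coordinates `x : T^{(k)} × {1,…,N} → ℝ` of II (2.28) (`In (inSet N T^{(k)})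
→ ℝ`, the carrier of `condGauss … Finset.univ`), the field being `fieldOfCrd Finset.univ x`; `C` = the charge datum of the
covariant operators, `Ω ⊂ T_ε` the Neumann region and `B` the external field of `Δ^{(k)}(Ω, B)` (paper I: `Ω = T_ε`,
`B ↤ B^{(k+1)}`), `m²`, `a` as in (2.30); ONE threshold `t` for both characteristic functions (print: `p₁(L^kε)` on the unit
lattice, i.e. `t = (L^kε)^{−(d−2)/2}p₁(L^kε)` in `ε`-units — `B1Eq343FluctuationChi.chiFluctA_printed`); `V^{(k)}` as a real
function of `(A′, φ′)` (its other arguments `B^{(k+1)}, ψ` — Prop. 3.2: `V^{(k)}(B^{(k+1)}, ψ, A′^{(k)}, φ′)` — held fixed), exactly the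
argument r12's schematic takes.

WHAT IS PROVED (kernel-checked, 0 `sorry`, standard axioms; one definition WITH BODY + theorems; NO `Prop`-valued fact).
 * `integral356C` — (3.56) with body; `integral356C_eq_integral356` (`rfl`: it IS r12's `integral356` at the concrete measures,
   cut-offs and coordinates).
 * `integral356C_nonneg` (`χ ≥ 0`, `exp > 0`).
 * `integral356C_le_exp`: if `V^{(k)} ≤ M` pointwise then (3.56) `≤ e^{M}` (m², μ₀² > 0, a > 0, L > 1, k ≤ K: both measures are
   probability measures; `0 ≤ χ ≤ 1`).
 * `integral356C_zero`: at `V = 0` the integral is `(∫χ(A′)dμ_{C^{(k)}}) · (∫χ(φ′)dμ_{C^{(k)}(B)})`, and `integral356C_zero_mem_Icc`: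
   this number lies in `[0, 1]` — the two small-field probabilities that (3.57)–(3.61) go on to estimate.
HONEST SCOPE.  (a) A DEFINITION display typed with a body; NOTHING of the calculation announced by the sentence after (3.56)
((3.57)–(3.61), Lemma p. 623) is here.  (b) The scalar measure is realised on coordinates (II (2.28)), as everywhere in the
tree's B2 files; no separate push-forward to a measure on fields is introduced.  (c) Convergence: for `V` unbounded above the
Bochner integral may be the junk value `0`; the bounds proved assume `V ≤ M` or `V = 0`.  (d) `Ω`, `B`, `t`, `V` are
arguments (print: `Ω = T_ε`, `B = B^{(k+1)}`, `t` from `p₁(L^kε)`, `V = V^{(k)}` of Prop. 3.2 (3.57)).  Value = r12's class-E row B1.Eq3.56 gets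
its carrier member; NOT summit progress.  Unit `lit-balaban-r14` gen 23 (literature-prover-lit-balaban-r14-g23-0); HOME/FILED.md
records the proposal.
-/

open scoped BigOperators
open _root_.MeasureTheory

namespace Literature.MathematicalPhysics.QuantumFieldTheory.Balaban1983to89.B1Eq356FluctuationIntegral

open HiggsLattice HiggsAveraging HiggsCovariance HiggsFluctMeasure
open HiggsCondGauss228 (condGauss fieldOfCrd inSet isProbabilityMeasure_condGauss)
open B2Eq228Conditioning (In)
open B1Eq343FluctuationChi (chiFluctA chiFluctφ chiFluctA_nonneg chiFluctφ_nonneg chiFluctA_le_one chiFluctφ_le_one)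
open B1Sect3Statements (integral356)

variable {P : HiggsLattice.Params} {N : ℕ}

variable (C : ChargeData N) (Ω : Finset (HiggsLattice.Site P 0)) (B : HiggsLattice.VecField P 0) (μ0sq msq a : ℝ) (k : ℕ)
  (t : ℝ) (V : HiggsLattice.VecField P k → HiggsLattice.ScalarField P k N → ℝ)

/-- **(3.56)** p. 622 [PDF 20], verbatim: *"The next step is a calculation of the integral ∫dμ_{C^{(k)}}(A′) ∫dμ_{C^{(k)}(B^{(k+1)})}(φ′)
χ(A′)χ(φ′) exp(V^{(k)}). (3.56)"* — WITH BODY on the carrier: the outer integral against the typer's Gaussian probability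
measure `dμ_{C^{(k)}}` of the vector fluctuation field (`fluctMeasure P μ₀² a k`), the inner one against the Gaussian probability
measure with covariance `C^{(k)}(Ω, B)` of the scalar fluctuation field in the coordinates of II (2.28) (`condGauss C Ω B m² a k T^{(k)}`,
field `fieldOfCrd T^{(k)} x`), the cut-offs `χ(A′)`, `χ(φ′)` of (3.43)/(3.50) with threshold `t`, and `exp(V^{(k)}(A′, φ′))`.
[cite: Balaban1982Higgs1, (3.56) p.622] -/
noncomputable def integral356C : ℝ :=
  ∫ A', ∫ x, chiFluctA t A' * chiFluctφ t (fieldOfCrd (Finset.univ : Finset (HiggsLattice.Site P k)) x)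
      * Real.exp (V A' (fieldOfCrd Finset.univ x))
    ∂(condGauss C Ω B msq a k (Finset.univ : Finset (HiggsLattice.Site P k))) ∂(fluctMeasure P μ0sq a k)

/-- **(3.56) with body IS r12's schematic decl of record** `B1Sect3Statements.integral356 μA μφ χA χφ V` at the concrete
measures, cut-offs and coordinates (definitional). [cite: Balaban1982Higgs1, (3.56) p.622] -/
theorem integral356C_eq_integral356 :
    integral356C C Ω B μ0sq msq a k t V
      = integral356 (fluctMeasure P μ0sq a k) (condGauss C Ω B msq a k (Finset.univ : Finset (HiggsLattice.Site P k)))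
          (chiFluctA t) (fun x => chiFluctφ t (fieldOfCrd (Finset.univ : Finset (HiggsLattice.Site P k)) x))
          (fun A' x => V A' (fieldOfCrd Finset.univ x)) := rfl

/-- The integrand of (3.56) is nonnegative. [cite: Balaban1982Higgs1, (3.56) p.622] -/
theorem integrand356_nonneg (A' : HiggsLattice.VecField P k) (x : In (inSet (P := P) N (Finset.univ : Finset (HiggsLattice.Site P k))) → ℝ) :
    0 ≤ chiFluctA t A' * chiFluctφ t (fieldOfCrd (Finset.univ : Finset (HiggsLattice.Site P k)) x)
      * Real.exp (V A' (fieldOfCrd Finset.univ x)) :=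
  mul_nonneg (mul_nonneg (chiFluctA_nonneg t A') (chiFluctφ_nonneg t _)) (Real.exp_pos _).le

/-- The integrand of (3.56) is at most `e^{M}` when `V^{(k)} ≤ M` (`0 ≤ χ ≤ 1`). [cite: Balaban1982Higgs1, (3.56) p.622] -/
theorem integrand356_le_exp {M : ℝ} (hV : ∀ A' φ', V A' φ' ≤ M) (A' : HiggsLattice.VecField P k)
    (x : In (inSet (P := P) N (Finset.univ : Finset (HiggsLattice.Site P k))) → ℝ) :
    chiFluctA t A' * chiFluctφ t (fieldOfCrd (Finset.univ : Finset (HiggsLattice.Site P k)) x)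
      * Real.exp (V A' (fieldOfCrd Finset.univ x)) ≤ Real.exp M := by
  have hχ : chiFluctA t A' * chiFluctφ t (fieldOfCrd (Finset.univ : Finset (HiggsLattice.Site P k)) x) ≤ 1 :=
    mul_le_one₀ (chiFluctA_le_one t A') (chiFluctφ_nonneg t _) (chiFluctφ_le_one t _)
  calc chiFluctA t A' * chiFluctφ t (fieldOfCrd (Finset.univ : Finset (HiggsLattice.Site P k)) x)
        * Real.exp (V A' (fieldOfCrd Finset.univ x))
      ≤ 1 * Real.exp M :=
        mul_le_mul hχ (Real.exp_le_exp.mpr (hV _ _)) (Real.exp_pos _).le zero_le_one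
    _ = Real.exp M := one_mul _

/-- **(3.56) is nonnegative.** [cite: Balaban1982Higgs1, (3.56) p.622] -/
theorem integral356C_nonneg : 0 ≤ integral356C C Ω B μ0sq msq a k t V :=
  integral_nonneg fun A' => integral_nonneg fun x => integrand356_nonneg k t V A' x

/-- On a probability measure a nonnegative function bounded by `c` has integral at most `c` (no integrability needed:
a non-integrable integrand has integral `0 ≤ c`). [cite: Balaban1982Higgs1, (3.56) p.622] -/
theorem integral_le_of_nonneg_of_le {X : Type*} [MeasurableSpace X] (μ : Measure X) [IsProbabilityMeasure μ]
    {f : X → ℝ} {c : ℝ} (h0 : ∀ x, 0 ≤ f x) (hc : ∀ x, f x ≤ c) : ∫ x, f x ∂μ ≤ c := by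
  have h := integral_mono_of_nonneg (μ := μ) (Filter.Eventually.of_forall h0) (integrable_const c)
    (Filter.Eventually.of_forall hc)
  simpa using h

/-- **(3.56) `≤ e^{M}` when `V^{(k)} ≤ M`** (m², μ₀² > 0, a > 0, L > 1, k ≤ K: both Gaussian measures are probability
measures — `HiggsFluctMeasurePos.fluctMeasure_isProbability`, `HiggsCondGauss228.isProbabilityMeasure_condGauss`).
[cite: Balaban1982Higgs1, (3.56) p.622] -/
theorem integral356C_le_exp {μ0sq msq a : ℝ} (hμ : 0 < μ0sq) (hmsq : 0 < msq) (ha : 0 < a) (hL : 1 < (P.L : ℝ))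
    {k : ℕ} (hk : k ≤ P.K) (t : ℝ) (V : HiggsLattice.VecField P k → HiggsLattice.ScalarField P k N → ℝ) {M : ℝ}
    (hV : ∀ A' φ', V A' φ' ≤ M) : integral356C C Ω B μ0sq msq a k t V ≤ Real.exp M := by
  haveI := HiggsFluctMeasurePos.fluctMeasure_isProbability (P := P) hμ ha hL hk
  haveI := isProbabilityMeasure_condGauss C Ω B hmsq ha hL hk (Finset.univ : Finset (HiggsLattice.Site P k))
  refine integral_le_of_nonneg_of_le _ (fun A' => integral_nonneg fun x => integrand356_nonneg k t V A' x)
    fun A' => ?_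
  exact integral_le_of_nonneg_of_le _ (fun x => integrand356_nonneg k t V A' x)
    fun x => integrand356_le_exp k t V hV A' x

/-- **(3.56) at `V = 0`: the product of the two small-field probabilities** `(∫χ(A′)dμ_{C^{(k)}})·(∫χ(φ′)dμ_{C^{(k)}(Ω,B)})`.
[cite: Balaban1982Higgs1, (3.56) p.622] -/
theorem integral356C_zero :
    integral356C C Ω B μ0sq msq a k t (fun _ _ => 0)
      = (∫ A', chiFluctA t A' ∂(fluctMeasure P μ0sq a k))
        * ∫ x, chiFluctφ t (fieldOfCrd (Finset.univ : Finset (HiggsLattice.Site P k)) x)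
            ∂(condGauss C Ω B msq a k (Finset.univ : Finset (HiggsLattice.Site P k))) := by
  unfold integral356C
  simp only [Real.exp_zero, mul_one]
  simp_rw [integral_const_mul]
  rw [integral_mul_const]

/-- **At `V = 0` the integral (3.56) lies in `[0, 1]`** (m², μ₀² > 0, a > 0, L > 1, k ≤ K). [cite: Balaban1982Higgs1, (3.56) p.622] -/
theorem integral356C_zero_mem_Icc {μ0sq msq a : ℝ} (hμ : 0 < μ0sq) (hmsq : 0 < msq) (ha : 0 < a) (hL : 1 < (P.L : ℝ))
    {k : ℕ} (hk : k ≤ P.K) (t : ℝ) :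
    integral356C C Ω B μ0sq msq a k t (fun _ _ => 0) ∈ Set.Icc (0 : ℝ) 1 := by
  refine ⟨integral356C_nonneg C Ω B μ0sq msq a k t _, ?_⟩
  have h := integral356C_le_exp C Ω B hμ hmsq ha hL hk t (fun _ _ => (0 : ℝ)) (M := 0) fun _ _ => le_rfl
  simpa using h

end Literature.MathematicalPhysics.QuantumFieldTheory.Balaban1983to89.B1Eq356FluctuationIntegral
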